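import Mathlib.Analysis.SpecialFunctions.Pow.Deriv
import Mathlib.Analysis.ODE.Gronwall
import Literature.Analysis.FluidPDE.CompressibleEulerExactSelfSimilarImplosion
import Literature.Analysis.ODE.FlowDomain
import HarnessLib

/-!
# The far field of the self-similar implosion profile of the monatomic gas (theorems only)

Topic `Literature/Analysis/FluidPDE`; namespace `Literature.Analysis.FluidPDE.CaolaboraEtAl2025`.
Companion of `CompressibleEulerImplosion.lean` (the named fact
`BuckmasterCaolaboraGomezserrano2025_thm11_monatomic`: the `γ = 5/3` self-similar PROFILE `(U, S)`
of Buckmaster–Cao-Labora–Gómez-Serrano, *Smooth imploding solutions for 3D compressible fluids*,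
Forum Math. Pi 13 (2025), arXiv:2208.09445, Thm 1.1) and of
`CompressibleEulerExactSelfSimilarImplosion.lean` (the exact self-similar solution it generates,
`exactSolution_of_profile`; the decay `U′, S′ → 0`, `tendsto_deriv_profile_atTop`). THEOREMS
ONLY, no definitions, no new facts (D-0026).

## The result

`farField_of_profile`: for a profile as recorded in the vendored fact (smooth radial fields,
the radial profile equations `(r−1)U + (ζ+U)U′ + ⅓SS′ = 0`,
`(r−1)S + (ζ+U)S′ + ⅓S(U′ + 2U/ζ) = 0` for `ζ > 0`, `S > 0`, and the end point `P_∞ = (0,0)`,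
i.e. `U/ζ, S/ζ → 0` at `∞`; `1 < r < 2`) there are `ε > 0` and functions `A, B` SMOOTH ON
`(−ε, ∞)` with `B(0) > 0` and

  `U(ζ) = ζ^{1−r} A(ζ^{−r})`,  `S(ζ) = ζ^{1−r} B(ζ^{−r})`  for all `ζ > 0`.

Consequently the profile has the far-field behaviour `U, S = ζ^{1−r}(c + O(ζ^{−r}))` to every
order of differentiation, with positive sound-speed coefficient — property (1.6) p. 6 of
Cao-Labora–Gómez-Serrano–Shi–Staffilani (arXiv:2310.05325) for these profiles,
"`|∇ʲŪ| + |∇ʲS̄| ≲ ⟨R⟩^{−(r−1)−j}` and `S̄ ≳ ⟨R⟩^{−r+1}`" — and, in the physical variables of the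
exact solution `u = r⁻¹(T−t)^{1/r−1}U(|x|/(T−t)^{1/r})`, the identity
`u(t, x) = r⁻¹|x|^{1−r}A((T−t)|x|^{−r})`: AWAY FROM THE ORIGIN THE EXACT SELF-SIMILAR SOLUTION
IS SMOOTH UP TO AND ACROSS THE BLOW-UP TIME, with the explicit terminal state
`u(T, x) = (A(0)/r)|x|^{−r}x`, `σ(T, x) = (B(0)/r)|x|^{1−r}`. This is the input of the transplant
of the implosion to the torus by finite speed of propagation (Cao-Labora–Gómez-Serrano–Shi–
Staffilani, Rem. 1.5) in the programme of `CompressibleEulerImplosionRates.lean`.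

## The proof

In the phase portrait of BCG (§2) `P_∞` is a stable node of the autonomous system with the
double eigenvalue `−r`; equal eigenvalues are non-resonant, and the blow-up `W = s·g`,
`s = ζ^{−r} = e^{−rξ}`, turns `P_∞` into a REGULAR point. Concretely (`farField_ode`): with
`a(s) := s^{(1−r)/r}U(s^{−1/r})`, `b(s) := s^{(1−r)/r}S(s^{−1/r})` (`farField_repr`), the profile
equations become `r(1 + sa)a′ + (r/3)sbb′ = (1−r)(a² + b²/3)`,
`(r/3)sba′ + r(1 + sa)b′ = ((6−4r)/3)ab`, a smooth system `(a, b)′ = F(s, a, b)` wherever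
`(1 + sa)² ≠ (sb/3)²`, in particular near `{s = 0}` (`farField_ode_solved`,
`contDiffOn_farField_field`). The hypothesis `P_∞` says only `sa, sb → 0` as `s → 0⁺`; since
`|F| ≤ 7(a² + b²)` in the region `|sa|, |sb| ≤ ½` (`farField_F1_le`, `farField_F2_le'`), the
function `m = (a² + b²)^{−1/2}` is `14`-Lipschitz there, which together with
`s(a² + b²)^{1/2} → 0` bounds `a² + b²` near `0` (`farField_bounded`); bounded derivatives give
limits `a₀, b₀` at `0⁺` (`tendsto_nhdsGT_of_deriv_bounded`); `b′ = b·G` with `G` bounded keeps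
`b ≥ β > 0` (`farField_F2_le`, `exists_pos_le_of_logDeriv_bounded`), so `b₀ > 0`; finally the
smooth local solution of the regular system through `(0, (a₀, b₀))` (Lang's smooth flow, tree
theorem `Literature.Analysis.ODE.exists_contDiffOn_flow_timeDependent`) coincides with `(a, b)`
on `(0, ε)` by Grönwall's inequality on `[η, t]`, `η → 0⁺` (Mathlib
`dist_le_of_trajectories_ODE_of_mem`), and extends it smoothly across `s = 0`
(`exists_smooth_extension_of_tendsto`).

## Mathlib / tree search

Mathlib: `Real.hasDerivAt_rpow_const`, `Convex.norm_image_sub_le_of_norm_hasDerivWithin_le`,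
`MonotoneOn.tendsto_nhdsWithin_Ioo_right`, `ContDiffAt.exists_lipschitzOnWith`,
`dist_le_of_trajectories_ODE_of_mem`, `contDiffOn_of_locally_contDiffOn`, `nhdsGT_basis`.
Tree: `contDiffAt_profile_of_radialField/Scalar` (`CompressibleEulerExactSelfSimilarImplosion`),
`Literature.Analysis.ODE.exists_contDiffOn_flow_timeDependent` (`ODE/FlowDomain`). Nothing on the
far field / `P_∞` asymptotics of the profile (`lean search 'farField|P_∞|atInfinity'` in
FluidPDE: none beyond `tendsto_deriv_profile_atTop`, `profile_sq_le_rpow`).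

## References

* T. Buckmaster, G. Cao-Labora, J. Gómez-Serrano, arXiv:2208.09445 = Forum Math. Pi 13 (2025),
  Thm 1.1, §1.3 (self-similar variables), §2 (phase portrait, the point `P_∞`).
  [`BuckmasterCaolaboraGomezserrano2025`]
* G. Cao-Labora, J. Gómez-Serrano, J. Shi, G. Staffilani, arXiv:2310.05325 = Camb. J. Math. 13
  (2025), (1.6) p. 6 and Rem. 1.5 p. 7. [`CaolaboraEtAl2025`]
-/

noncomputable section

open Set Filter Topology Metric
open scoped ContDiff

namespace Literature.Analysis.FluidPDE

namespace CaolaboraEtAl2025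

variable {r : ℝ} {U S a b : ℝ → ℝ}

/-! ### Far-field variables `s = ζ^{-r}`, `U = ζ^{1-r} a(s)`, `S = ζ^{1-r} b(s)` -/

section Algebra

/-- `(ζ^{-r})^{-1/r} = ζ` for `ζ > 0`, `r ≠ 0`. [folklore] -/
theorem rpow_neg_rpow_neg_inv {ζ r : ℝ} (hζ : 0 < ζ) (hr : r ≠ 0) :
    (ζ ^ (-r)) ^ (-1 / r) = ζ := by
  rw [← Real.rpow_mul hζ.le, show -r * (-1 / r) = 1 by field_simp, Real.rpow_one]

/-- `(ζ^{-r})^{(1-r)/r} = ζ^{r-1}` for `ζ > 0`, `r ≠ 0`. [folklore] -/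
theorem rpow_neg_rpow_div {ζ r : ℝ} (hζ : 0 < ζ) (hr : r ≠ 0) :
    (ζ ^ (-r)) ^ ((1 - r) / r) = ζ ^ (r - 1) := by
  rw [← Real.rpow_mul hζ.le]; congr 1; field_simp; ring

/-- `ζ^{1-r} = ζ · ζ^{-r}` for `ζ > 0`. [folklore] -/
theorem rpow_one_sub_eq_mul {ζ r : ℝ} (hζ : 0 < ζ) : ζ ^ (1 - r) = ζ * ζ ^ (-r) := by
  rw [sub_eq_add_neg, Real.rpow_add hζ, Real.rpow_one]

/-- `ζ^{1-r} · ζ^{-r-1} = (ζ^{-r})²` for `ζ > 0`. [folklore] -/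
theorem rpow_one_sub_mul_rpow {ζ r : ℝ} (hζ : 0 < ζ) :
    ζ ^ (1 - r) * ζ ^ (-r - 1) = (ζ ^ (-r)) ^ 2 := by
  rw [← Real.rpow_add hζ, sq, ← Real.rpow_add hζ]; congr 1; ring

/-- `ζ^{1-r} · ζ^{r-1} = 1` for `ζ > 0`. [folklore] -/
theorem rpow_one_sub_mul_rpow_sub_one {ζ r : ℝ} (hζ : 0 < ζ) :
    ζ ^ (1 - r) * ζ ^ (r - 1) = 1 := by
  rw [← Real.rpow_add hζ, show 1 - r + (r - 1) = 0 by ring, Real.rpow_zero]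

/-- **The far-field representation.** With `a(s) := s^{(1-r)/r} U(s^{-1/r})` one has
`U(ζ) = ζ^{1-r} a(ζ^{-r})` for `ζ > 0` (`r ≠ 0`). [cite: BuckmasterCaolaboraGomezserrano2025, §1.3 (self-similar variables)] -/
theorem farField_repr {U : ℝ → ℝ} {r : ℝ} (hr : r ≠ 0) {ζ : ℝ} (hζ : 0 < ζ) :
    U ζ = ζ ^ (1 - r) * ((ζ ^ (-r)) ^ ((1 - r) / r) * U ((ζ ^ (-r)) ^ (-1 / r))) := by
  rw [rpow_neg_rpow_neg_inv hζ hr, rpow_neg_rpow_div hζ hr, ← mul_assoc,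
    rpow_one_sub_mul_rpow_sub_one hζ, one_mul]

/-- Smoothness of `a(s) = s^{(1-r)/r} U(s^{-1/r})` on `(0, ∞)` from smoothness of `U` on
`(0, ∞)`. [folklore] -/
theorem contDiffOn_farField (hU : ∀ ζ, 0 < ζ → ContDiffAt ℝ ∞ U ζ) :
    ContDiffOn ℝ ∞ (fun s => s ^ ((1 - r) / r) * U (s ^ (-1 / r))) (Ioi 0) := by
  intro s hs
  have hs0 : (s : ℝ) ≠ 0 := (ne_of_gt hs)
  have h1 : ContDiffAt ℝ ∞ (fun s : ℝ => s ^ ((1 - r) / r)) s :=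
    Real.contDiffAt_rpow_const_of_ne hs0
  have h2 : ContDiffAt ℝ ∞ (fun s : ℝ => s ^ (-1 / r)) s := Real.contDiffAt_rpow_const_of_ne hs0
  have h3 : ContDiffAt ℝ ∞ U (s ^ (-1 / r)) := hU _ (Real.rpow_pos_of_pos hs _)
  exact (h1.mul (h3.comp s h2)).contDiffWithinAt

/-- Derivative of the far-field representation: if `a` has derivative `a'` at `s = ζ^{-r}` then
`z ↦ z^{1-r} a(z^{-r})` has derivative `(1-r) s a(s) − r s² a'` at `ζ > 0`. [folklore] -/
theorem hasDerivAt_farField_repr {a : ℝ → ℝ} {r a' ζ : ℝ} (hζ : 0 < ζ)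
    (ha : HasDerivAt a a' (ζ ^ (-r))) :
    HasDerivAt (fun z => z ^ (1 - r) * a (z ^ (-r)))
      ((1 - r) * ζ ^ (-r) * a (ζ ^ (-r)) - r * (ζ ^ (-r)) ^ 2 * a') ζ := by
  have h1 : HasDerivAt (fun z : ℝ => z ^ (1 - r)) ((1 - r) * ζ ^ (1 - r - 1)) ζ :=
    Real.hasDerivAt_rpow_const (Or.inl hζ.ne')
  have h2 : HasDerivAt (fun z : ℝ => z ^ (-r)) (-r * ζ ^ (-r - 1)) ζ :=
    Real.hasDerivAt_rpow_const (Or.inl hζ.ne')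
  have h3 : HasDerivAt (fun z => a (z ^ (-r))) (a' * (-r * ζ ^ (-r - 1))) ζ := ha.comp ζ h2
  refine (h1.mul h3).congr_deriv ?_
  rw [show (1 - r - 1 : ℝ) = -r by ring]
  have h4 := rpow_one_sub_mul_rpow (r := r) hζ
  linear_combination (-(r * a')) * h4

/-- **The profile equations in the far-field variables.** If `U = ζ^{1-r}a(ζ^{-r})`,
`S = ζ^{1-r}b(ζ^{-r})` on `(0, ∞)` and the radial profile equations of the monatomic gas
`(r−1)U + (ζ+U)U′ + ⅓SS′ = 0`, `(r−1)S + (ζ+U)S′ + ⅓S(U′ + 2U/ζ) = 0` hold at `ζ > 0`, then at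
`s = ζ^{-r}`, with `A = a(s)`, `B = b(s)`,
`r(1 + sA)a′ + (r/3) s B b′ = (1−r)(A² + B²/3)` and
`(r/3) s B a′ + r(1 + sA) b′ = ((6−4r)/3) A B` — a system which is REGULAR at `s = 0` (the
point at infinity `P_∞` of the phase portrait). [cite: BuckmasterCaolaboraGomezserrano2025, §1.3 and §2 (the point `P_∞`)] -/
theorem farField_ode {U S a b : ℝ → ℝ} {r a' b' ζ : ℝ} (hζ : 0 < ζ)
    (hU : ∀ z, 0 < z → U z = z ^ (1 - r) * a (z ^ (-r)))
    (hS : ∀ z, 0 < z → S z = z ^ (1 - r) * b (z ^ (-r)))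
    (ha : HasDerivAt a a' (ζ ^ (-r))) (hb : HasDerivAt b b' (ζ ^ (-r)))
    (h1 : (r - 1) * U ζ + (ζ + U ζ) * deriv U ζ + 1 / 3 * S ζ * deriv S ζ = 0)
    (h2 : (r - 1) * S ζ + (ζ + U ζ) * deriv S ζ + 1 / 3 * S ζ * (deriv U ζ + 2 * U ζ / ζ) = 0) :
    r * (1 + ζ ^ (-r) * a (ζ ^ (-r))) * a' + r / 3 * ζ ^ (-r) * b (ζ ^ (-r)) * b' =
        (1 - r) * (a (ζ ^ (-r)) ^ 2 + b (ζ ^ (-r)) ^ 2 / 3) ∧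
      r / 3 * ζ ^ (-r) * b (ζ ^ (-r)) * a' + r * (1 + ζ ^ (-r) * a (ζ ^ (-r))) * b' =
        (6 - 4 * r) / 3 * a (ζ ^ (-r)) * b (ζ ^ (-r)) := by
  -- the derivatives of `U`, `S` at `ζ` from the representation (valid near `ζ`)
  have hevU : (fun z => z ^ (1 - r) * a (z ^ (-r))) =ᶠ[𝓝 ζ] U := by
    filter_upwards [Ioi_mem_nhds hζ] with z hz using (hU z hz).symm
  have hevS : (fun z => z ^ (1 - r) * b (z ^ (-r))) =ᶠ[𝓝 ζ] S := by
    filter_upwards [Ioi_mem_nhds hζ] with z hz using (hS z hz).symm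
  have hdU : deriv U ζ = (1 - r) * ζ ^ (-r) * a (ζ ^ (-r)) - r * (ζ ^ (-r)) ^ 2 * a' :=
    ((hasDerivAt_farField_repr hζ ha).congr_of_eventuallyEq hevU.symm).deriv
  have hdS : deriv S ζ = (1 - r) * ζ ^ (-r) * b (ζ ^ (-r)) - r * (ζ ^ (-r)) ^ 2 * b' :=
    ((hasDerivAt_farField_repr hζ hb).congr_of_eventuallyEq hevS.symm).deriv
  set σ : ℝ := ζ ^ (-r) with hσ
  set A : ℝ := a σ
  set B : ℝ := b σ
  have hσ0 : 0 < σ := Real.rpow_pos_of_pos hζ _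
  have hUζ : U ζ = ζ * σ * A := by rw [hU ζ hζ, rpow_one_sub_eq_mul hζ]
  have hSζ : S ζ = ζ * σ * B := by rw [hS ζ hζ, rpow_one_sub_eq_mul hζ]
  have hq : 2 * U ζ / ζ = 2 * σ * A := by rw [hUζ]; field_simp
  rw [hq] at h2
  rw [hUζ, hSζ, hdU, hdS] at h1 h2
  have hz : ζ * σ ^ 2 ≠ 0 := mul_ne_zero hζ.ne' (pow_ne_zero 2 hσ0.ne')
  constructor
  · have key : ζ * σ ^ 2 * (r * (1 + σ * A) * a' + r / 3 * σ * B * b' -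
        (1 - r) * (A ^ 2 + B ^ 2 / 3)) = 0 := by
      linear_combination (-1 : ℝ) * h1
    have := (mul_eq_zero.1 key).resolve_left hz
    linarith
  · have key : ζ * σ ^ 2 * (r / 3 * σ * B * a' + r * (1 + σ * A) * b' -
        (6 - 4 * r) / 3 * A * B) = 0 := by
      linear_combination (-1 : ℝ) * h2
    have := (mul_eq_zero.1 key).resolve_left hz
    linarith

/-- **Solved form of the far-field system** (Cramer): off the locus
`(1 + sA)² = (sB/3)²` the system of `farField_ode` reads `a′ = F₁/Δ`, `b′ = F₂/Δ` with
`Δ = r((1+sA)² − (sB/3)²)`. [folklore] -/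
theorem farField_ode_solved {r s A B a' b' : ℝ} (hr : r ≠ 0)
    (hΔ : (1 + s * A) ^ 2 - (s * B / 3) ^ 2 ≠ 0)
    (h1 : r * (1 + s * A) * a' + r / 3 * s * B * b' = (1 - r) * (A ^ 2 + B ^ 2 / 3))
    (h2 : r / 3 * s * B * a' + r * (1 + s * A) * b' = (6 - 4 * r) / 3 * A * B) :
    a' = ((1 + s * A) * ((1 - r) * (A ^ 2 + B ^ 2 / 3)) - s * B / 3 * ((6 - 4 * r) / 3 * A * B)) /
        (r * ((1 + s * A) ^ 2 - (s * B / 3) ^ 2)) ∧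
      b' = ((1 + s * A) * ((6 - 4 * r) / 3 * A * B) - s * B / 3 * ((1 - r) * (A ^ 2 + B ^ 2 / 3))) /
        (r * ((1 + s * A) ^ 2 - (s * B / 3) ^ 2)) := by
  have hD : r * ((1 + s * A) ^ 2 - (s * B / 3) ^ 2) ≠ 0 := mul_ne_zero hr hΔ
  constructor
  · rw [eq_div_iff hD]
    linear_combination (1 + s * A) * h1 - s * B / 3 * h2
  · rw [eq_div_iff hD]
    linear_combination (1 + s * A) * h2 - s * B / 3 * h1

end Algebra

/-! ### A priori bounds: the far-field variables stay bounded as `s → 0⁺` -/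

section Bounded

/-- **Quadratic growth ⇒ boundedness near `s = 0`.** Let `a, b` be differentiable on `(0, s₁]`
with `|a′|, |b′| ≤ K (a² + b²)`, `a² + b² > 0`, and `s²(a² + b²) → 0` as `s → 0⁺`. Then
`a² + b²` is bounded on some `(0, s₀]`. Proof: `m = (a² + b²)^{-1/2}` has `|m′| ≤ 2K`, so
`m(s) ≥ m(s₀) − 2K s₀ ≥ m(s₀)/2` once `4K s₀ ≤ m(s₀)`, i.e. `4K s₀ (a² + b²)^{1/2}(s₀) ≤ 1`.
[folklore] -/
theorem farField_bounded {a b fa fb : ℝ → ℝ} {K s₁ : ℝ} (hs₁ : 0 < s₁) (hK : 0 ≤ K)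
    (hda : ∀ s ∈ Ioc 0 s₁, HasDerivAt a (fa s) s) (hdb : ∀ s ∈ Ioc 0 s₁, HasDerivAt b (fb s) s)
    (hfa : ∀ s ∈ Ioc 0 s₁, |fa s| ≤ K * (a s ^ 2 + b s ^ 2))
    (hfb : ∀ s ∈ Ioc 0 s₁, |fb s| ≤ K * (a s ^ 2 + b s ^ 2))
    (hpos : ∀ s ∈ Ioc 0 s₁, 0 < a s ^ 2 + b s ^ 2)
    (hlim : Tendsto (fun s => s ^ 2 * (a s ^ 2 + b s ^ 2)) (𝓝[>] 0) (𝓝 0)) :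
    ∃ s₀ ∈ Ioc 0 s₁, ∃ N : ℝ, 0 < N ∧ ∀ s ∈ Ioc 0 s₀, a s ^ 2 + b s ^ 2 ≤ N := by
  -- the auxiliary function `m = 1/√(a² + b²)` and its derivative bound `|m′| ≤ 2K`
  set n : ℝ → ℝ := fun s => a s ^ 2 + b s ^ 2 with hn
  set m : ℝ → ℝ := fun s => (Real.sqrt (n s))⁻¹ with hm
  have hmd : ∀ s ∈ Ioc 0 s₁, ∃ m' : ℝ, HasDerivAt m m' s ∧ |m'| ≤ 2 * K := by
    intro s hs
    have hn0 : 0 < n s := hpos s hs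
    have hsq0 : 0 < Real.sqrt (n s) := Real.sqrt_pos.2 hn0
    have hnd : HasDerivAt n (2 * a s * fa s + 2 * b s * fb s) s := by
      have h := ((hda s hs).pow 2).add ((hdb s hs).pow 2)
      refine HasDerivAt.congr_deriv (f := n) h ?_
      push_cast
      ring
    have hsqd : HasDerivAt (fun x => Real.sqrt (n x))
        ((2 * a s * fa s + 2 * b s * fb s) / (2 * Real.sqrt (n s))) s := hnd.sqrt hn0.ne'
    have hmd' : HasDerivAt m (-((2 * a s * fa s + 2 * b s * fb s) / (2 * Real.sqrt (n s))) /
        Real.sqrt (n s) ^ 2) s := hsqd.inv hsq0.ne'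
    refine ⟨_, hmd', ?_⟩
    -- `|n′| ≤ 4K n √n`, so `|m′| = |n′| / (2 n √n) ≤ 2K`
    have ha : |a s| ≤ Real.sqrt (n s) :=
      Real.abs_le_sqrt (by simp only [hn]; nlinarith [sq_nonneg (b s)])
    have hb : |b s| ≤ Real.sqrt (n s) :=
      Real.abs_le_sqrt (by simp only [hn]; nlinarith [sq_nonneg (a s)])
    have hn' : |2 * a s * fa s + 2 * b s * fb s| ≤ 4 * K * n s * Real.sqrt (n s) := by
      have e1 : |2 * a s * fa s| ≤ 2 * Real.sqrt (n s) * (K * n s) := by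
        rw [abs_mul, abs_mul, abs_two]
        exact mul_le_mul (by linarith) (hfa s hs) (abs_nonneg _) (by positivity)
      have e2 : |2 * b s * fb s| ≤ 2 * Real.sqrt (n s) * (K * n s) := by
        rw [abs_mul, abs_mul, abs_two]
        exact mul_le_mul (by linarith) (hfb s hs) (abs_nonneg _) (by positivity)
      calc |2 * a s * fa s + 2 * b s * fb s| ≤ |2 * a s * fa s| + |2 * b s * fb s| := abs_add_le _ _
        _ ≤ 2 * Real.sqrt (n s) * (K * n s) + 2 * Real.sqrt (n s) * (K * n s) := add_le_add e1 e2
        _ = 4 * K * n s * Real.sqrt (n s) := by ring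
    have hsq2 : Real.sqrt (n s) ^ 2 = n s := Real.sq_sqrt hn0.le
    rw [abs_div, abs_neg, abs_div, hsq2, abs_of_pos hn0, abs_of_pos (by positivity : 0 < 2 * Real.sqrt (n s)),
      div_div, div_le_iff₀ (by positivity)]
    calc |2 * a s * fa s + 2 * b s * fb s| ≤ 4 * K * n s * Real.sqrt (n s) := hn'
      _ = 2 * K * (2 * Real.sqrt (n s) * n s) := by ring
  -- choose `s₀` with `4K s₀ √(n s₀) ≤ 1`
  have hlim' : Tendsto (fun s => s * Real.sqrt (n s)) (𝓝[>] 0) (𝓝 0) := by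
    have h := hlim.sqrt
    rw [Real.sqrt_zero] at h
    refine h.congr' ?_
    filter_upwards [self_mem_nhdsWithin] with s (hs : 0 < s)
    rw [Real.sqrt_mul (sq_nonneg s), Real.sqrt_sq hs.le]
  obtain ⟨s₀, hs₀small, hs₀⟩ : ∃ s₀, s₀ * Real.sqrt (n s₀) < 1 / (4 * K + 4) ∧ s₀ ∈ Ioc 0 s₁ := by
    have hev : ∀ᶠ s in 𝓝[>] (0 : ℝ), s * Real.sqrt (n s) < 1 / (4 * K + 4) :=
      hlim' (gt_mem_nhds (by positivity))
    exact (hev.and (Ioc_mem_nhdsGT hs₁)).exists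
  have hn0 : 0 < n s₀ := hpos s₀ hs₀
  have hsq0 : 0 < Real.sqrt (n s₀) := Real.sqrt_pos.2 hn0
  refine ⟨s₀, hs₀, 4 * n s₀, by positivity, fun s hs => ?_⟩
  -- mean value inequality for `m` on `[s, s₀]`
  have hsub : Icc s s₀ ⊆ Ioc 0 s₁ := fun x hx => ⟨hs.1.trans_le hx.1, hx.2.trans hs₀.2⟩
  choose! m' hm' using hmd
  have hMVT : ‖m s₀ - m s‖ ≤ 2 * K * ‖s₀ - s‖ :=
    (convex_Icc s s₀).norm_image_sub_le_of_norm_hasDerivWithin_le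
      (fun x hx => ((hm' x (hsub hx)).1).hasDerivWithinAt)
      (fun x hx => by simpa [Real.norm_eq_abs] using (hm' x (hsub hx)).2)
      (left_mem_Icc.2 hs.2) (right_mem_Icc.2 hs.2)
  rw [Real.norm_eq_abs, Real.norm_eq_abs, abs_of_nonneg (sub_nonneg.2 hs.2)] at hMVT
  -- `4K s₀ ≤ m s₀`
  have hK4 : 4 * K * s₀ ≤ m s₀ := by
    have h1 : s₀ * Real.sqrt (n s₀) * (4 * K + 4) < 1 := by
      rwa [lt_div_iff₀ (by positivity)] at hs₀small
    have h0 : 0 ≤ s₀ * Real.sqrt (n s₀) := mul_nonneg hs₀.1.le hsq0.le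
    show 4 * K * s₀ ≤ (Real.sqrt (n s₀))⁻¹
    rw [inv_eq_one_div, le_div_iff₀ hsq0]
    nlinarith [mul_nonneg hK h0]
  -- hence `m s ≥ m s₀ / 2 > 0` and `n s ≤ 4 n s₀`
  have hms : m s₀ / 2 ≤ m s := by
    have := (abs_sub_le_iff.1 hMVT).1
    nlinarith [hs.1, hs.2]
  have hm0 : 0 < m s₀ := inv_pos.2 hsq0
  have hns0 : 0 < n s := hpos s ⟨hs.1, hs.2.trans hs₀.2⟩
  have hsqs : 0 < Real.sqrt (n s) := Real.sqrt_pos.2 hns0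
  have hinv : Real.sqrt (n s) ≤ 2 * Real.sqrt (n s₀) := by
    have h2 : (Real.sqrt (n s₀))⁻¹ / 2 ≤ (Real.sqrt (n s))⁻¹ := hms
    have h3 : (2 * Real.sqrt (n s₀))⁻¹ = (Real.sqrt (n s₀))⁻¹ / 2 := by
      field_simp
    rw [← h3] at h2
    exact (inv_le_inv₀ (by positivity) hsqs).1 h2
  have h4 : n s ≤ 4 * n s₀ := by
    have h5 : Real.sqrt (n s) ^ 2 ≤ (2 * Real.sqrt (n s₀)) ^ 2 :=
      pow_le_pow_left₀ hsqs.le hinv 2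
    rw [Real.sq_sqrt hns0.le, mul_pow, Real.sq_sqrt hn0.le] at h5
    linarith
  exact h4

/-- A function on `(0, s₀)` with bounded derivative has a limit at `0⁺` (`f + Ls` is monotone
and bounded). [folklore] -/
theorem tendsto_nhdsGT_of_deriv_bounded {f f' : ℝ → ℝ} {s₀ L : ℝ} (hs₀ : 0 < s₀)
    (hd : ∀ s ∈ Ioo 0 s₀, HasDerivAt f (f' s) s) (hL : ∀ s ∈ Ioo 0 s₀, |f' s| ≤ L) :
    ∃ l : ℝ, Tendsto f (𝓝[>] 0) (𝓝 l) := by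
  set g : ℝ → ℝ := fun s => f s + L * s with hg
  have hL0 : 0 ≤ L := (abs_nonneg _).trans (hL (s₀ / 2) ⟨by linarith, by linarith⟩)
  have hgd : ∀ s ∈ Ioo 0 s₀, HasDerivAt g (f' s + L) s := fun s hs => by
    have h := (hd s hs).add ((hasDerivAt_id' s).const_mul L)
    rw [mul_one] at h
    exact h
  have hcont : ContinuousOn g (Ioo 0 s₀) := fun s hs => (hgd s hs).continuousAt.continuousWithinAt
  have hmono : MonotoneOn g (Ioo 0 s₀) := by
    refine monotoneOn_of_deriv_nonneg (convex_Ioo 0 s₀) hcont ?_ ?_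
    · rw [interior_Ioo]; exact fun s hs => (hgd s hs).differentiableAt.differentiableWithinAt
    · rw [interior_Ioo]; intro s hs
      rw [(hgd s hs).deriv]
      linarith [neg_abs_le (f' s), hL s hs]
  -- `f` is bounded on `(0, s₀)` (mean value inequality from the midpoint), hence so is `g`
  have hbdd : BddBelow (g '' Ioo 0 s₀) := by
    refine ⟨f (s₀ / 2) - L * s₀, ?_⟩
    rintro _ ⟨s, hs, rfl⟩
    have hsub : Icc (min s (s₀ / 2)) (max s (s₀ / 2)) ⊆ Ioo 0 s₀ := fun x hx =>
      ⟨lt_of_lt_of_le (lt_min hs.1 (by linarith)) hx.1,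
        lt_of_le_of_lt hx.2 (max_lt hs.2 (by linarith))⟩
    have hMVT : ‖f s - f (s₀ / 2)‖ ≤ L * ‖s - s₀ / 2‖ :=
      (convex_Icc _ _).norm_image_sub_le_of_norm_hasDerivWithin_le
        (fun x hx => (hd x (hsub hx)).hasDerivWithinAt)
        (fun x hx => by simpa [Real.norm_eq_abs] using hL x (hsub hx))
        ⟨min_le_right _ _, le_max_right _ _⟩ ⟨min_le_left _ _, le_max_left _ _⟩
    rw [Real.norm_eq_abs, Real.norm_eq_abs] at hMVT
    have h1 : |s - s₀ / 2| ≤ s₀ / 2 := abs_le.2 ⟨by linarith [hs.1], by linarith [hs.2]⟩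
    have h2 := (abs_sub_le_iff.1 hMVT).2
    show f (s₀ / 2) - L * s₀ ≤ f s + L * s
    nlinarith [hs.1, mul_le_mul_of_nonneg_left h1 hL0]
  have hglim := hmono.tendsto_nhdsWithin_Ioo_right (nonempty_Ioo.2 hs₀) hbdd
  refine ⟨sInf (g '' Ioo 0 s₀) - L * 0, ?_⟩
  have hlin : Tendsto (fun s : ℝ => L * s) (𝓝[>] 0) (𝓝 (L * 0)) :=
    ((continuous_const.mul continuous_id).tendsto 0).mono_left nhdsWithin_le_nhds
  have := hglim.sub hlin
  exact this.congr fun s => by simp [hg]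

/-- **Positivity floor from a bounded logarithmic derivative.** If `b > 0` on `(0, s₀]` with
`|b′| ≤ M b`, then `b ≥ β > 0` there (`log b` is `M`-Lipschitz). [folklore] -/
theorem exists_pos_le_of_logDeriv_bounded {b b' : ℝ → ℝ} {s₀ M : ℝ} (hs₀ : 0 < s₀)
    (hd : ∀ s ∈ Ioc 0 s₀, HasDerivAt b (b' s) s) (hpos : ∀ s ∈ Ioc 0 s₀, 0 < b s)
    (hM : ∀ s ∈ Ioc 0 s₀, |b' s| ≤ M * b s) :
    ∃ β : ℝ, 0 < β ∧ ∀ s ∈ Ioc 0 s₀, β ≤ b s := by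
  have hs₀m : s₀ ∈ Ioc 0 s₀ := ⟨hs₀, le_rfl⟩
  have hM0 : 0 ≤ M := by
    have h := hM s₀ hs₀m
    have hb := hpos s₀ hs₀m
    nlinarith [abs_nonneg (b' s₀)]
  refine ⟨Real.exp (Real.log (b s₀) - M * s₀), Real.exp_pos _, fun s hs => ?_⟩
  have hsub : Icc s s₀ ⊆ Ioc 0 s₀ := fun x hx => ⟨hs.1.trans_le hx.1, hx.2⟩
  have hld : ∀ x ∈ Icc s s₀, HasDerivWithinAt (fun y => Real.log (b y)) (b' x / b x) (Icc s s₀) x :=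
    fun x hx => ((hd x (hsub hx)).log (hpos x (hsub hx)).ne').hasDerivWithinAt
  have hMVT : ‖Real.log (b s₀) - Real.log (b s)‖ ≤ M * ‖s₀ - s‖ :=
    (convex_Icc s s₀).norm_image_sub_le_of_norm_hasDerivWithin_le hld
      (fun x hx => by
        rw [Real.norm_eq_abs, abs_div, abs_of_pos (hpos x (hsub hx)),
          div_le_iff₀ (hpos x (hsub hx))]
        exact hM x (hsub hx))
      (left_mem_Icc.2 hs.2) (right_mem_Icc.2 hs.2)
  rw [Real.norm_eq_abs, Real.norm_eq_abs, abs_of_nonneg (sub_nonneg.2 hs.2)] at hMVT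
  have h1 := (abs_sub_le_iff.1 hMVT).1
  calc Real.exp (Real.log (b s₀) - M * s₀) ≤ Real.exp (Real.log (b s)) :=
        Real.exp_le_exp.2 (by nlinarith [hs.1])
    _ = b s := Real.exp_log (hpos s hs)

end Bounded

/-! ### Extension through `s = 0` by the regular ODE -/

section Extension

variable {E : Type*} [NormedAddCommGroup E] [NormedSpace ℝ E] [CompleteSpace E]

/-- **Smooth extension through a regular point.** Let `F` be smooth on an open set
`Ω ∋ (0, y₀)` of `ℝ × E`, and let `y` solve `y′ = F(s, y)` on `(0, s₀)` with `y(s) → y₀` as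
`s → 0⁺`. Then `y` agrees on some `(0, ε)` with a function `Y` smooth on `(−ε, ε)`, `Y(0) = y₀`:
the local solution through `(0, y₀)` (Lang's smooth flow, tree theorem
`Literature.Analysis.ODE.exists_contDiffOn_flow_timeDependent`), which coincides with `y` by
Grönwall's inequality on `[η, t]`, `η → 0⁺`. [folklore] -/
theorem exists_smooth_extension_of_tendsto {F : ℝ × E → E} {Ω : Set (ℝ × E)} (hΩ : IsOpen Ω)
    (hF : ContDiffOn ℝ ∞ F Ω) {y₀ : E} (h₀ : ((0 : ℝ), y₀) ∈ Ω) {y : ℝ → E} {s₀ : ℝ}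
    (hs₀ : 0 < s₀) (hy : ∀ s ∈ Ioo 0 s₀, HasDerivAt y (F (s, y s)) s)
    (hlim : Tendsto y (𝓝[>] 0) (𝓝 y₀)) :
    ∃ ε : ℝ, 0 < ε ∧ ∃ Y : ℝ → E, ContDiffOn ℝ ∞ Y (Ioo (-ε) ε) ∧ Y 0 = y₀ ∧
      (∀ s ∈ Ioo (-ε) ε, HasDerivAt Y (F (s, Y s)) s) ∧ ∀ s ∈ Ioo 0 ε, Y s = y s := by
  -- the smooth local solution through `(0, y₀)`
  obtain ⟨φ, rad, hrad, ε, hε, hφ0, hφd, hφs⟩ :=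
    Literature.Analysis.ODE.exists_contDiffOn_flow_timeDependent (n := (⊤ : ℕ∞)) hΩ hF le_top h₀
  set Y : ℝ → E := φ y₀ with hYdef
  have hy₀ : y₀ ∈ ball y₀ rad := mem_ball_self hrad
  have hY0 : Y 0 = y₀ := hφ0 y₀ hy₀
  have hYd : ∀ s ∈ Ioo (-ε) ε, HasDerivAt Y (F (s, Y s)) s := fun s hs => by
    have := (hφd y₀ hy₀ s (by simpa using hs)).1
    exact this
  have hYs : ContDiffOn ℝ ∞ Y (Ioo (-ε) ε) := by
    have hcomp : ContDiffOn ℝ ∞ (fun t : ℝ => (y₀, t)) (Ioo (-ε) ε) :=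
      (contDiffOn_const.prodMk contDiffOn_id)
    have hmaps : MapsTo (fun t : ℝ => (y₀, t)) (Ioo (-ε) ε) (ball y₀ rad ×ˢ Ioo (0 - ε) (0 + ε)) :=
      fun t ht => ⟨hy₀, by simpa using ht⟩
    exact hφs.comp hcomp hmaps
  -- a neighbourhood of `(0, y₀)` on which `F` is Lipschitz
  have hF1 : ContDiffAt ℝ 1 F (0, y₀) := (hF.of_le (by simp)).contDiffAt (hΩ.mem_nhds h₀)
  obtain ⟨K, t, ht, hKt⟩ := hF1.exists_lipschitzOnWith
  obtain ⟨δ₁, hδ₁, hball⟩ := Metric.mem_nhds_iff.1 ht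
  have hLip : ∀ s : ℝ, |s| < δ₁ → LipschitzOnWith K (fun x => F (s, x)) (ball y₀ δ₁) := by
    intro s hs
    refine LipschitzOnWith.of_dist_le_mul fun x hx x' hx' => ?_
    have hm : ∀ z ∈ ball y₀ δ₁, ((s, z) : ℝ × E) ∈ t := fun z hz =>
      hball (by
        rw [mem_ball, Prod.dist_eq, Real.dist_eq, sub_zero]
        exact max_lt hs (mem_ball.1 hz))
    have h := hKt.dist_le_mul (s, x) (hm x hx) (s, x') (hm x' hx')
    rwa [Prod.dist_eq, dist_self, max_eq_right dist_nonneg] at h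
  -- both curves stay in the ball for small positive times
  have hYc : ContinuousAt Y 0 := (hYd 0 (by simp [hε])).continuousAt
  obtain ⟨δ₂, hδ₂, hYball⟩ : ∃ δ₂ > 0, ∀ s, |s| < δ₂ → Y s ∈ ball y₀ δ₁ := by
    have hev : ∀ᶠ s in 𝓝 (0 : ℝ), Y s ∈ ball y₀ δ₁ := by
      have := hYc.preimage_mem_nhds (x := 0) (by rw [hY0]; exact ball_mem_nhds y₀ hδ₁)
      exact this
    obtain ⟨δ₂, hδ₂, h⟩ := Metric.eventually_nhds_iff.1 hev
    exact ⟨δ₂, hδ₂, fun s hs => h (by simpa [Real.dist_eq] using hs)⟩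
  obtain ⟨δ₃, hδ₃, hyball⟩ : ∃ δ₃ > 0, ∀ s ∈ Ioo 0 δ₃, y s ∈ ball y₀ δ₁ := by
    have hev : ∀ᶠ s in 𝓝[>] (0 : ℝ), y s ∈ ball y₀ δ₁ := hlim (ball_mem_nhds y₀ hδ₁)
    obtain ⟨u, hu, h⟩ := ((nhdsGT_basis (0 : ℝ)).eventually_iff).1 hev
    exact ⟨u, hu, fun s hs => h hs⟩
  -- the common time interval
  set ε' : ℝ := min (min ε δ₁) (min δ₂ (min δ₃ s₀)) with hε'
  have hε'pos : 0 < ε' := by positivity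
  have hε'ε : ε' ≤ ε := (min_le_left _ _).trans (min_le_left _ _)
  have hε'δ₁ : ε' ≤ δ₁ := (min_le_left _ _).trans (min_le_right _ _)
  have hε'δ₂ : ε' ≤ δ₂ := (min_le_right _ _).trans (min_le_left _ _)
  have hε'δ₃ : ε' ≤ δ₃ := (min_le_right _ _).trans ((min_le_right _ _).trans (min_le_left _ _))
  have hε's₀ : ε' ≤ s₀ := (min_le_right _ _).trans ((min_le_right _ _).trans (min_le_right _ _))
  refine ⟨ε', hε'pos, Y, hYs.mono (Ioo_subset_Ioo (neg_le_neg hε'ε) hε'ε), hY0,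
    fun s hs => hYd s (Ioo_subset_Ioo (neg_le_neg hε'ε) hε'ε hs), fun t ht => ?_⟩
  -- Grönwall on `[η, t]` for every `0 < η < t`, then `η → 0⁺`
  have hG : ∀ η ∈ Ioo 0 t, dist (Y t) (y t) ≤ dist (Y η) (y η) * Real.exp (K * t) := by
    intro η hη
    have hIcc : ∀ x ∈ Icc η t, x ∈ Ioo 0 ε' := fun x hx => ⟨hη.1.trans_le hx.1, hx.2.trans_lt ht.2⟩
    have hYd' : ∀ x ∈ Icc η t, HasDerivAt Y (F (x, Y x)) x := fun x hx =>
      hYd x (Ioo_subset_Ioo (neg_le_neg hε'ε) hε'ε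
        ⟨by linarith [(hIcc x hx).1, hε'pos], (hIcc x hx).2⟩)
    have hyd' : ∀ x ∈ Icc η t, HasDerivAt y (F (x, y x)) x := fun x hx =>
      hy x ⟨(hIcc x hx).1, (hIcc x hx).2.trans_le hε's₀⟩
    have h := dist_le_of_trajectories_ODE_of_mem (v := fun s x => F (s, x)) (s := fun _ => ball y₀ δ₁)
      (K := K) (f := Y) (g := y) (a := η) (b := t) (δ := dist (Y η) (y η))
      (fun x hx => hLip x (by
        rw [abs_lt]; constructor <;> linarith [hx.1, hη.1, hx.2, ht.2, hε'δ₁]))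
      (fun x hx => (hYd' x hx).continuousAt.continuousWithinAt)
      (fun x hx => (hYd' x (Ico_subset_Icc_self hx)).hasDerivWithinAt)
      (fun x hx => hYball x (by
        rw [abs_lt]; constructor <;> linarith [hx.1, hη.1, hx.2, ht.2, hε'δ₂]))
      (fun x hx => (hyd' x hx).continuousAt.continuousWithinAt)
      (fun x hx => (hyd' x (Ico_subset_Icc_self hx)).hasDerivWithinAt)
      (fun x hx => hyball x ⟨hη.1.trans_le hx.1, hx.2.trans (ht.2.trans_le hε'δ₃)⟩)
      le_rfl t (right_mem_Icc.2 hη.2.le)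
    refine h.trans (mul_le_mul_of_nonneg_left (Real.exp_le_exp.2 ?_) dist_nonneg)
    nlinarith [K.2, hη.1, hη.2]
  -- the right-hand side tends to `0`
  have hlim0 : Tendsto (fun η => dist (Y η) (y η) * Real.exp (K * t)) (𝓝[>] 0) (𝓝 0) := by
    have hY' : Tendsto Y (𝓝[>] 0) (𝓝 y₀) := by
      rw [← hY0]; exact hYc.tendsto.mono_left nhdsWithin_le_nhds
    have h := (hY'.dist hlim).mul_const (Real.exp (K * t))
    rwa [dist_self, zero_mul] at h
  have hle : dist (Y t) (y t) ≤ 0 :=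
    ge_of_tendsto hlim0 (by
      filter_upwards [Ioo_mem_nhdsGT ht.1] with η hη using hG η hη)
  exact dist_le_zero.1 hle

end Extension

/-! ### Pointwise bounds on the far-field vector field -/

section FieldBounds

/-- The determinant of the far-field system is `≥ 2/9` while `|sA|, |sB| ≤ 1/2`. [folklore] -/
theorem farField_det_ge {s A B : ℝ} (hA : |s * A| ≤ 1 / 2) (hB : |s * B| ≤ 1 / 2) :
    2 / 9 ≤ (1 + s * A) ^ 2 - (s * B / 3) ^ 2 := by
  have h1 : 1 / 2 ≤ 1 + s * A := by linarith [neg_abs_le (s * A)]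
  have h2 : (s * B / 3) ^ 2 ≤ 1 / 36 := by
    have : |s * B / 3| ≤ 1 / 6 := by rw [abs_div, abs_of_pos (by norm_num : (0:ℝ) < 3)]; linarith
    nlinarith [abs_nonneg (s * B / 3), sq_abs (s * B / 3)]
  nlinarith

/-- **Quadratic bound for the first component** of the far-field vector field
(`1 ≤ r ≤ 2`, `|sA|, |sB| ≤ 1/2`): `|a′| ≤ 7 (A² + B²)`. [folklore] -/
theorem farField_F1_le {r s A B : ℝ} (hr1 : 1 ≤ r) (hr2 : r ≤ 2) (hA : |s * A| ≤ 1 / 2)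
    (hB : |s * B| ≤ 1 / 2) :
    |((1 + s * A) * ((1 - r) * (A ^ 2 + B ^ 2 / 3)) - s * B / 3 * ((6 - 4 * r) / 3 * A * B)) /
        (r * ((1 + s * A) ^ 2 - (s * B / 3) ^ 2))| ≤ 7 * (A ^ 2 + B ^ 2) := by
  have hdet := farField_det_ge hA hB
  have hden : 0 < r * ((1 + s * A) ^ 2 - (s * B / 3) ^ 2) := by nlinarith
  have hn : 0 ≤ A ^ 2 + B ^ 2 := by positivity
  -- numerator `≤ (3/2 + 1/18)(A² + B²)`
  have e1 : |(1 + s * A) * ((1 - r) * (A ^ 2 + B ^ 2 / 3))| ≤ 3 / 2 * (A ^ 2 + B ^ 2) := by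
    rw [abs_mul, abs_mul]
    have h1 : |1 + s * A| ≤ 3 / 2 := abs_le.2 ⟨by linarith [neg_abs_le (s * A), le_abs_self (s * A)],
      by linarith [le_abs_self (s * A)]⟩
    have h2 : |1 - r| ≤ 1 := abs_le.2 ⟨by linarith, by linarith⟩
    have h3 : |A ^ 2 + B ^ 2 / 3| ≤ A ^ 2 + B ^ 2 := by
      rw [abs_of_nonneg (by positivity)]; nlinarith [sq_nonneg B]
    calc |1 + s * A| * (|1 - r| * |A ^ 2 + B ^ 2 / 3|) ≤ 3 / 2 * (1 * (A ^ 2 + B ^ 2)) :=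
          mul_le_mul h1 (mul_le_mul h2 h3 (abs_nonneg _) zero_le_one) (by positivity) (by norm_num)
      _ = 3 / 2 * (A ^ 2 + B ^ 2) := by ring
  have e2 : |s * B / 3 * ((6 - 4 * r) / 3 * A * B)| ≤ 1 / 18 * (A ^ 2 + B ^ 2) := by
    rw [abs_mul, show (6 - 4 * r) / 3 * A * B = (6 - 4 * r) / 3 * (A * B) by ring, abs_mul]
    have h1 : |s * B / 3| ≤ 1 / 6 := by
      rw [abs_div, abs_of_pos (by norm_num : (0:ℝ) < 3)]; linarith
    have h2 : |(6 - 4 * r) / 3| ≤ 2 / 3 := by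
      rw [abs_div, abs_of_pos (by norm_num : (0:ℝ) < 3)]
      have : |6 - 4 * r| ≤ 2 := abs_le.2 ⟨by linarith, by linarith⟩
      linarith
    have h3 : |A * B| ≤ (A ^ 2 + B ^ 2) / 2 := by
      rw [abs_mul]; nlinarith [sq_nonneg (|A| - |B|), sq_abs A, sq_abs B]
    calc |s * B / 3| * (|(6 - 4 * r) / 3| * |A * B|) ≤ 1 / 6 * (2 / 3 * ((A ^ 2 + B ^ 2) / 2)) :=
          mul_le_mul h1 (mul_le_mul h2 h3 (abs_nonneg _) (by norm_num)) (by positivity) (by norm_num)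
      _ = 1 / 18 * (A ^ 2 + B ^ 2) := by ring
  rw [abs_div, abs_of_pos hden, div_le_iff₀ hden]
  calc |(1 + s * A) * ((1 - r) * (A ^ 2 + B ^ 2 / 3)) - s * B / 3 * ((6 - 4 * r) / 3 * A * B)|
      ≤ 3 / 2 * (A ^ 2 + B ^ 2) + 1 / 18 * (A ^ 2 + B ^ 2) := (abs_sub _ _).trans (add_le_add e1 e2)
    _ ≤ 7 * (A ^ 2 + B ^ 2) * (r * ((1 + s * A) ^ 2 - (s * B / 3) ^ 2)) := by
        have hD : 2 / 9 ≤ r * ((1 + s * A) ^ 2 - (s * B / 3) ^ 2) := by nlinarith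
        nlinarith [mul_le_mul_of_nonneg_left hD hn]

/-- **Quadratic bound for the second component** (`1 ≤ r ≤ 2`, `|sA|, |sB| ≤ 1/2`):
`|b′| ≤ 7 (A² + B²)`. [folklore] -/
theorem farField_F2_le' {r s A B : ℝ} (hr1 : 1 ≤ r) (hr2 : r ≤ 2) (hA : |s * A| ≤ 1 / 2)
    (hB : |s * B| ≤ 1 / 2) :
    |((1 + s * A) * ((6 - 4 * r) / 3 * A * B) - s * B / 3 * ((1 - r) * (A ^ 2 + B ^ 2 / 3))) /
        (r * ((1 + s * A) ^ 2 - (s * B / 3) ^ 2))| ≤ 7 * (A ^ 2 + B ^ 2) := by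
  have hdet := farField_det_ge hA hB
  have hden : 0 < r * ((1 + s * A) ^ 2 - (s * B / 3) ^ 2) := by nlinarith
  have hn : 0 ≤ A ^ 2 + B ^ 2 := by positivity
  have e1 : |(1 + s * A) * ((6 - 4 * r) / 3 * A * B)| ≤ 1 / 2 * (A ^ 2 + B ^ 2) := by
    rw [show (6 - 4 * r) / 3 * A * B = (6 - 4 * r) / 3 * (A * B) by ring, abs_mul, abs_mul]
    have h1 : |1 + s * A| ≤ 3 / 2 := abs_le.2 ⟨by linarith [neg_abs_le (s * A), le_abs_self (s * A)],
      by linarith [le_abs_self (s * A)]⟩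
    have h2 : |(6 - 4 * r) / 3| ≤ 2 / 3 := by
      rw [abs_div, abs_of_pos (by norm_num : (0:ℝ) < 3)]
      have : |6 - 4 * r| ≤ 2 := abs_le.2 ⟨by linarith, by linarith⟩
      linarith
    have h3 : |A * B| ≤ (A ^ 2 + B ^ 2) / 2 := by
      rw [abs_mul]; nlinarith [sq_nonneg (|A| - |B|), sq_abs A, sq_abs B]
    calc |1 + s * A| * (|(6 - 4 * r) / 3| * |A * B|) ≤ 3 / 2 * (2 / 3 * ((A ^ 2 + B ^ 2) / 2)) :=
          mul_le_mul h1 (mul_le_mul h2 h3 (abs_nonneg _) (by norm_num)) (by positivity) (by norm_num)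
      _ = 1 / 2 * (A ^ 2 + B ^ 2) := by ring
  have e2 : |s * B / 3 * ((1 - r) * (A ^ 2 + B ^ 2 / 3))| ≤ 1 / 6 * (A ^ 2 + B ^ 2) := by
    rw [abs_mul, abs_mul]
    have h1 : |s * B / 3| ≤ 1 / 6 := by
      rw [abs_div, abs_of_pos (by norm_num : (0:ℝ) < 3)]; linarith
    have h2 : |1 - r| ≤ 1 := abs_le.2 ⟨by linarith, by linarith⟩
    have h3 : |A ^ 2 + B ^ 2 / 3| ≤ A ^ 2 + B ^ 2 := by
      rw [abs_of_nonneg (by positivity)]; nlinarith [sq_nonneg B]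
    calc |s * B / 3| * (|1 - r| * |A ^ 2 + B ^ 2 / 3|) ≤ 1 / 6 * (1 * (A ^ 2 + B ^ 2)) :=
          mul_le_mul h1 (mul_le_mul h2 h3 (abs_nonneg _) zero_le_one) (by positivity) (by norm_num)
      _ = 1 / 6 * (A ^ 2 + B ^ 2) := by ring
  rw [abs_div, abs_of_pos hden, div_le_iff₀ hden]
  calc |(1 + s * A) * ((6 - 4 * r) / 3 * A * B) - s * B / 3 * ((1 - r) * (A ^ 2 + B ^ 2 / 3))|
      ≤ 1 / 2 * (A ^ 2 + B ^ 2) + 1 / 6 * (A ^ 2 + B ^ 2) := (abs_sub _ _).trans (add_le_add e1 e2)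
    _ ≤ 7 * (A ^ 2 + B ^ 2) * (r * ((1 + s * A) ^ 2 - (s * B / 3) ^ 2)) := by
        have hD : 2 / 9 ≤ r * ((1 + s * A) ^ 2 - (s * B / 3) ^ 2) := by nlinarith
        nlinarith [mul_le_mul_of_nonneg_left hD hn]

/-- **The second component factors through `B`**: for `1 ≤ r ≤ 2`, `|sA|, |sB| ≤ 1/2`,
`0 ≤ s ≤ 1`, `|b′| ≤ (9/2)(|A| + A² + B²)|B|` — the logarithmic derivative of `b` is bounded
where `(A, B)` is. [folklore] -/
theorem farField_F2_le {r s A B : ℝ} (hr1 : 1 ≤ r) (hr2 : r ≤ 2) (hA : |s * A| ≤ 1 / 2)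
    (hB : |s * B| ≤ 1 / 2) (hs0 : 0 ≤ s) (hs1 : s ≤ 1) :
    |((1 + s * A) * ((6 - 4 * r) / 3 * A * B) - s * B / 3 * ((1 - r) * (A ^ 2 + B ^ 2 / 3))) /
        (r * ((1 + s * A) ^ 2 - (s * B / 3) ^ 2))| ≤ 9 / 2 * (|A| + (A ^ 2 + B ^ 2)) * |B| := by
  have hdet := farField_det_ge hA hB
  have hden : 0 < r * ((1 + s * A) ^ 2 - (s * B / 3) ^ 2) := by nlinarith
  have hfac : (1 + s * A) * ((6 - 4 * r) / 3 * A * B) - s * B / 3 * ((1 - r) * (A ^ 2 + B ^ 2 / 3)) =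
      ((1 + s * A) * ((6 - 4 * r) / 3 * A) - s / 3 * ((1 - r) * (A ^ 2 + B ^ 2 / 3))) * B := by ring
  have e1 : |(1 + s * A) * ((6 - 4 * r) / 3 * A)| ≤ |A| := by
    rw [abs_mul, abs_mul]
    have h1 : |1 + s * A| ≤ 3 / 2 := abs_le.2 ⟨by linarith [neg_abs_le (s * A), le_abs_self (s * A)],
      by linarith [le_abs_self (s * A)]⟩
    have h2 : |(6 - 4 * r) / 3| ≤ 2 / 3 := by
      rw [abs_div, abs_of_pos (by norm_num : (0:ℝ) < 3)]
      have : |6 - 4 * r| ≤ 2 := abs_le.2 ⟨by linarith, by linarith⟩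
      linarith
    calc |1 + s * A| * (|(6 - 4 * r) / 3| * |A|) ≤ 3 / 2 * (2 / 3 * |A|) :=
          mul_le_mul h1 (mul_le_mul_of_nonneg_right h2 (abs_nonneg _)) (by positivity) (by norm_num)
      _ = |A| := by ring
  have e2 : |s / 3 * ((1 - r) * (A ^ 2 + B ^ 2 / 3))| ≤ A ^ 2 + B ^ 2 := by
    rw [abs_mul, abs_mul]
    have h1 : |s / 3| ≤ 1 / 3 := by rw [abs_div, abs_of_nonneg hs0, abs_of_pos (by norm_num : (0:ℝ) < 3)]; linarith
    have h2 : |1 - r| ≤ 1 := abs_le.2 ⟨by linarith, by linarith⟩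
    have h3 : |A ^ 2 + B ^ 2 / 3| ≤ A ^ 2 + B ^ 2 := by
      rw [abs_of_nonneg (by positivity)]; nlinarith [sq_nonneg B]
    calc |s / 3| * (|1 - r| * |A ^ 2 + B ^ 2 / 3|) ≤ 1 / 3 * (1 * (A ^ 2 + B ^ 2)) :=
          mul_le_mul h1 (mul_le_mul h2 h3 (abs_nonneg _) zero_le_one) (by positivity) (by norm_num)
      _ ≤ A ^ 2 + B ^ 2 := by nlinarith [sq_nonneg A, sq_nonneg B]
  rw [hfac, abs_div, abs_of_pos hden, div_le_iff₀ hden, abs_mul]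
  have e3 : |(1 + s * A) * ((6 - 4 * r) / 3 * A) - s / 3 * ((1 - r) * (A ^ 2 + B ^ 2 / 3))| ≤
      |A| + (A ^ 2 + B ^ 2) := (abs_sub _ _).trans (add_le_add e1 e2)
  have hBnn := abs_nonneg B
  have hAnn : 0 ≤ |A| + (A ^ 2 + B ^ 2) := by positivity
  calc |(1 + s * A) * ((6 - 4 * r) / 3 * A) - s / 3 * ((1 - r) * (A ^ 2 + B ^ 2 / 3))| * |B|
      ≤ (|A| + (A ^ 2 + B ^ 2)) * |B| := mul_le_mul_of_nonneg_right e3 hBnn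
    _ ≤ 9 / 2 * (|A| + (A ^ 2 + B ^ 2)) * |B| * (r * ((1 + s * A) ^ 2 - (s * B / 3) ^ 2)) := by
        have : 1 ≤ 9 / 2 * (r * ((1 + s * A) ^ 2 - (s * B / 3) ^ 2)) := by nlinarith
        nlinarith [mul_nonneg hAnn hBnn]

/-- The far-field vector field is smooth off the locus where its determinant vanishes.
[folklore] -/
theorem contDiffOn_farField_field (r : ℝ) :
    ContDiffOn ℝ ∞ (fun p : ℝ × (ℝ × ℝ) =>
      ((((1 + p.1 * p.2.1) * ((1 - r) * (p.2.1 ^ 2 + p.2.2 ^ 2 / 3)) -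
          p.1 * p.2.2 / 3 * ((6 - 4 * r) / 3 * p.2.1 * p.2.2)) /
          (r * ((1 + p.1 * p.2.1) ^ 2 - (p.1 * p.2.2 / 3) ^ 2)),
        ((1 + p.1 * p.2.1) * ((6 - 4 * r) / 3 * p.2.1 * p.2.2) -
          p.1 * p.2.2 / 3 * ((1 - r) * (p.2.1 ^ 2 + p.2.2 ^ 2 / 3))) /
          (r * ((1 + p.1 * p.2.1) ^ 2 - (p.1 * p.2.2 / 3) ^ 2))) : ℝ × ℝ))
      {p | r * ((1 + p.1 * p.2.1) ^ 2 - (p.1 * p.2.2 / 3) ^ 2) ≠ 0} := by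
  have h1 : ContDiff ℝ ∞ fun p : ℝ × (ℝ × ℝ) => p.1 := contDiff_fst
  have h2 : ContDiff ℝ ∞ fun p : ℝ × (ℝ × ℝ) => p.2.1 := contDiff_fst.comp contDiff_snd
  have h3 : ContDiff ℝ ∞ fun p : ℝ × (ℝ × ℝ) => p.2.2 := contDiff_snd.comp contDiff_snd
  have hden : ContDiff ℝ ∞ fun p : ℝ × (ℝ × ℝ) =>
      r * ((1 + p.1 * p.2.1) ^ 2 - (p.1 * p.2.2 / 3) ^ 2) :=
    contDiff_const.mul (((contDiff_const.add (h1.mul h2)).pow 2).sub (((h1.mul h3).div_const 3).pow 2))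
  have hQ : ContDiff ℝ ∞ fun p : ℝ × (ℝ × ℝ) => (1 - r) * (p.2.1 ^ 2 + p.2.2 ^ 2 / 3) :=
    contDiff_const.mul ((h2.pow 2).add ((h3.pow 2).div_const 3))
  have hP : ContDiff ℝ ∞ fun p : ℝ × (ℝ × ℝ) => (6 - 4 * r) / 3 * p.2.1 * p.2.2 :=
    (contDiff_const.mul h2).mul h3
  have hn1 : ContDiff ℝ ∞ fun p : ℝ × (ℝ × ℝ) =>
      (1 + p.1 * p.2.1) * ((1 - r) * (p.2.1 ^ 2 + p.2.2 ^ 2 / 3)) -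
        p.1 * p.2.2 / 3 * ((6 - 4 * r) / 3 * p.2.1 * p.2.2) :=
    ((contDiff_const.add (h1.mul h2)).mul hQ).sub (((h1.mul h3).div_const 3).mul hP)
  have hn2 : ContDiff ℝ ∞ fun p : ℝ × (ℝ × ℝ) =>
      (1 + p.1 * p.2.1) * ((6 - 4 * r) / 3 * p.2.1 * p.2.2) -
        p.1 * p.2.2 / 3 * ((1 - r) * (p.2.1 ^ 2 + p.2.2 ^ 2 / 3)) :=
    ((contDiff_const.add (h1.mul h2)).mul hP).sub (((h1.mul h3).div_const 3).mul hQ)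
  exact (hn1.contDiffOn.div hden.contDiffOn fun p hp => hp).prodMk
    (hn2.contDiffOn.div hden.contDiffOn fun p hp => hp)

end FieldBounds

/-! ### The far field of the profile -/

section Assembly

open Literature.MathematicalPhysics.KineticTheory (V3)

/-- `s^{-1/r} → +∞` as `s → 0⁺` (`r > 0`). [folklore] -/
theorem tendsto_rpow_neg_inv_nhdsGT {r : ℝ} (hr : 0 < r) :
    Tendsto (fun s : ℝ => s ^ (-1 / r)) (𝓝[>] 0) atTop := by
  have h := (tendsto_rpow_atTop (one_div_pos.2 hr)).comp tendsto_inv_nhdsGT_zero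
  refine h.congr' ?_
  filter_upwards [self_mem_nhdsWithin] with s (hs : 0 < s)
  simp only [Function.comp_apply]
  rw [Real.inv_rpow hs.le, ← Real.rpow_neg hs.le, neg_div, one_div]

/-- **The far field of the self-similar profile (the point `P_∞`).** Let `(U, S)` be the radial
profile of a smooth self-similar implosion of the monatomic gas as recorded in the vendored fact
`BuckmasterCaolaboraGomezserrano2025_thm11_monatomic` (Buckmaster–Cao-Labora–Gómez-Serrano, Thm 1.1
at `γ = 5/3`): smooth radial fields, the profile equations for `ζ > 0`, `S > 0`, and the end point
`P_∞ = (0, 0)`, i.e. `U/ζ, S/ζ → 0` as `ζ → ∞`, with `1 < r < 2`. Then there are functions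
`A, B`, smooth on a neighbourhood `(−ε, ∞)` of `[0, ∞)`, with `B(0) > 0`, such that
`U(ζ) = ζ^{1−r} A(ζ^{−r})` and `S(ζ) = ζ^{1−r} B(ζ^{−r})` for all `ζ > 0`. In particular the
profile has the convergent far-field expansion `U, S ∼ ζ^{1−r}(c₀ + c₁ζ^{−r} + ⋯)` to every
order, with positive leading sound-speed coefficient — the statement "`S̄ ≳ ⟨R⟩^{−r+1}`,
`|∇ʲŪ| + |∇ʲS̄| ≲ ⟨R⟩^{−(r−1)−j}`" ((1.6) of Cao-Labora–Gómez-Serrano–Shi–Staffilani, p. 6, for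
these profiles). Proof: in the variable `s = ζ^{−r}` the point at infinity `P_∞` — a stable node
of the autonomous phase-plane system with equal eigenvalues `−r` (BCG §2) — becomes a REGULAR
point of the system `farField_ode`; the a priori information `sA, sB → 0` upgrades to
boundedness of `(A, B)` (`farField_bounded`), the bounded solution has a limit at `s = 0⁺`, `B`
stays away from `0` (its logarithmic derivative is bounded), and the local smooth solution of
the regular system through the limit point extends `(A, B)` smoothly across `s = 0`
(`exists_smooth_extension_of_tendsto`).
[cite: BuckmasterCaolaboraGomezserrano2025, Thm 1.1 and §2 (the point `P_∞`)]
[cite: CaolaboraEtAl2025, (1.6) p. 6] -/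
theorem farField_of_profile_Ioi {r : ℝ} {U S : ℝ → ℝ} (hr1 : 1 < r) (hr2 : r < 2)
    (hU : ContDiff ℝ ∞ fun y : V3 => (U ‖y‖ / ‖y‖) • y) (hS : ContDiff ℝ ∞ fun y : V3 => S ‖y‖)
    (hode : ∀ ζ : ℝ, 0 < ζ →
      (r - 1) * U ζ + (ζ + U ζ) * deriv U ζ + 1 / 3 * S ζ * deriv S ζ = 0 ∧
      (r - 1) * S ζ + (ζ + U ζ) * deriv S ζ + 1 / 3 * S ζ * (deriv U ζ + 2 * U ζ / ζ) = 0)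
    (hSpos : ∀ ζ : ℝ, 0 ≤ ζ → 0 < S ζ)
    (hlimU : Tendsto (fun ζ => U ζ / ζ) atTop (𝓝 0))
    (hlimS : Tendsto (fun ζ => S ζ / ζ) atTop (𝓝 0)) :
    ∃ ε : ℝ, 0 < ε ∧ ∃ A B : ℝ → ℝ, ContDiffOn ℝ ∞ A (Ioi (-ε)) ∧ ContDiffOn ℝ ∞ B (Ioi (-ε)) ∧
      0 < B 0 ∧ ∀ ζ : ℝ, 0 < ζ →
        U ζ = ζ ^ (1 - r) * A (ζ ^ (-r)) ∧ S ζ = ζ ^ (1 - r) * B (ζ ^ (-r)) := by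
  have hr0 : 0 < r := by linarith
  have hrne : r ≠ 0 := hr0.ne'
  -- the far-field variables
  set a : ℝ → ℝ := fun s => s ^ ((1 - r) / r) * U (s ^ (-1 / r)) with ha_def
  set b : ℝ → ℝ := fun s => s ^ ((1 - r) / r) * S (s ^ (-1 / r)) with hb_def
  have hUrep : ∀ ζ, 0 < ζ → U ζ = ζ ^ (1 - r) * a (ζ ^ (-r)) := fun ζ hζ => farField_repr hrne hζ
  have hSrep : ∀ ζ, 0 < ζ → S ζ = ζ ^ (1 - r) * b (ζ ^ (-r)) := fun ζ hζ => farField_repr hrne hζ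
  have has : ContDiffOn ℝ ∞ a (Ioi 0) :=
    contDiffOn_farField fun ζ hζ => contDiffAt_profile_of_radialField hU hζ
  have hbs : ContDiffOn ℝ ∞ b (Ioi 0) :=
    contDiffOn_farField fun ζ hζ => contDiffAt_profile_of_radialScalar hS hζ
  have hda : ∀ s, 0 < s → HasDerivAt a (deriv a s) s := fun s hs =>
    (((has.differentiableOn (by simp)) s hs).differentiableAt (Ioi_mem_nhds hs)).hasDerivAt
  have hdb : ∀ s, 0 < s → HasDerivAt b (deriv b s) s := fun s hs =>
    (((hbs.differentiableOn (by simp)) s hs).differentiableAt (Ioi_mem_nhds hs)).hasDerivAt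
  -- the inverse change of variables `ζ = s^{-1/r}`
  have hζ_of_s : ∀ s : ℝ, 0 < s → 0 < s ^ (-1 / r) ∧ (s ^ (-1 / r)) ^ (-r) = s := fun s hs =>
    ⟨Real.rpow_pos_of_pos hs _, by
      rw [← Real.rpow_mul hs.le, show (-1 / r) * (-r) = 1 by field_simp, Real.rpow_one]⟩
  -- positivity of `b`
  have hbpos : ∀ s, 0 < s → 0 < b s := fun s hs =>
    mul_pos (Real.rpow_pos_of_pos hs _) (hSpos _ (Real.rpow_pos_of_pos hs _).le)
  -- the system in the variable `s`
  have hE : ∀ s, 0 < s →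
      r * (1 + s * a s) * deriv a s + r / 3 * s * b s * deriv b s =
          (1 - r) * (a s ^ 2 + b s ^ 2 / 3) ∧
        r / 3 * s * b s * deriv a s + r * (1 + s * a s) * deriv b s =
          (6 - 4 * r) / 3 * a s * b s := by
    intro s hs
    obtain ⟨hζ, hζs⟩ := hζ_of_s s hs
    have ha' : HasDerivAt a (deriv a s) ((s ^ (-1 / r)) ^ (-r)) := by rw [hζs]; exact hda s hs
    have hb' : HasDerivAt b (deriv b s) ((s ^ (-1 / r)) ^ (-r)) := by rw [hζs]; exact hdb s hs
    have h := farField_ode hζ hUrep hSrep ha' hb' (hode _ hζ).1 (hode _ hζ).2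
    rw [hζs] at h
    exact h
  -- smallness: `s a(s) = U(ζ)/ζ → 0`, `s b(s) = S(ζ)/ζ → 0`
  have hkey : ∀ (W : ℝ → ℝ) (s : ℝ), 0 < s →
      s * (s ^ ((1 - r) / r) * W (s ^ (-1 / r))) = W (s ^ (-1 / r)) / s ^ (-1 / r) := by
    intro W s hs
    have h1 : s * s ^ ((1 - r) / r) = s ^ (1 / r) := by
      rw [show s * s ^ ((1 - r) / r) = s ^ (1 : ℝ) * s ^ ((1 - r) / r) by rw [Real.rpow_one],
        ← Real.rpow_add hs]
      congr 1; field_simp; ring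
    have h2 : (s ^ (-1 / r))⁻¹ = s ^ (1 / r) := by
      rw [neg_div, Real.rpow_neg hs.le, inv_inv]
    calc s * (s ^ ((1 - r) / r) * W (s ^ (-1 / r))) = s ^ (1 / r) * W (s ^ (-1 / r)) := by
          rw [← h1]; ring
      _ = W (s ^ (-1 / r)) / s ^ (-1 / r) := by
          rw [div_eq_mul_inv (W _) (s ^ (-1 / r)), h2, mul_comm]
  have hζlim := tendsto_rpow_neg_inv_nhdsGT hr0
  have hsa : Tendsto (fun s => s * a s) (𝓝[>] 0) (𝓝 0) := by
    refine (hlimU.comp hζlim).congr' ?_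
    filter_upwards [self_mem_nhdsWithin] with s (hs : 0 < s)
    exact (hkey U s hs).symm
  have hsb : Tendsto (fun s => s * b s) (𝓝[>] 0) (𝓝 0) := by
    refine (hlimS.comp hζlim).congr' ?_
    filter_upwards [self_mem_nhdsWithin] with s (hs : 0 < s)
    exact (hkey S s hs).symm
  -- the smallness region `(0, s₁]`, `s₁ ≤ 1`
  obtain ⟨s₁, hs₁, hs₁1, hsmall⟩ : ∃ s₁ : ℝ, 0 < s₁ ∧ s₁ ≤ 1 ∧
      ∀ s ∈ Ioc 0 s₁, |s * a s| ≤ 1 / 2 ∧ |s * b s| ≤ 1 / 2 := by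
    have hev : ∀ᶠ s in 𝓝[>] (0 : ℝ), |s * a s| < 1 / 2 ∧ |s * b s| < 1 / 2 := by
      have h1 : ∀ᶠ s in 𝓝[>] (0 : ℝ), |s * a s| < 1 / 2 := by
        have := (continuous_abs.tendsto 0).comp hsa
        rw [abs_zero] at this
        exact this (Iio_mem_nhds (by norm_num))
      have h2 : ∀ᶠ s in 𝓝[>] (0 : ℝ), |s * b s| < 1 / 2 := by
        have := (continuous_abs.tendsto 0).comp hsb
        rw [abs_zero] at this
        exact this (Iio_mem_nhds (by norm_num))
      exact h1.and h2
    obtain ⟨u, hu, h⟩ := ((nhdsGT_basis (0 : ℝ)).eventually_iff).1 hev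
    refine ⟨min (u / 2) 1, by positivity, min_le_right _ _, fun s hs => ?_⟩
    have hsu : s ∈ Ioo 0 u := ⟨hs.1, lt_of_le_of_lt (hs.2.trans (min_le_left _ _)) (by linarith)⟩
    exact ⟨(h hsu).1.le, (h hsu).2.le⟩
  -- on `(0, s₁]` the determinant is positive and the system is in solved form
  have hsolved : ∀ s ∈ Ioc 0 s₁,
      deriv a s = ((1 + s * a s) * ((1 - r) * (a s ^ 2 + b s ^ 2 / 3)) -
          s * b s / 3 * ((6 - 4 * r) / 3 * a s * b s)) / (r * ((1 + s * a s) ^ 2 - (s * b s / 3) ^ 2)) ∧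
        deriv b s = ((1 + s * a s) * ((6 - 4 * r) / 3 * a s * b s) -
          s * b s / 3 * ((1 - r) * (a s ^ 2 + b s ^ 2 / 3))) / (r * ((1 + s * a s) ^ 2 - (s * b s / 3) ^ 2)) := by
    intro s hs
    have hdet := farField_det_ge (hsmall s hs).1 (hsmall s hs).2
    exact farField_ode_solved hrne (by linarith) (hE s hs.1).1 (hE s hs.1).2
  -- boundedness near `0`
  obtain ⟨s₀, hs₀, N, hN, hbd⟩ := farField_bounded (a := a) (b := b) (fa := deriv a) (fb := deriv b)
    (K := 7) hs₁ (by norm_num) (fun s hs => hda s hs.1) (fun s hs => hdb s hs.1)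
    (fun s hs => by rw [(hsolved s hs).1]; exact farField_F1_le hr1.le hr2.le (hsmall s hs).1 (hsmall s hs).2)
    (fun s hs => by rw [(hsolved s hs).2]; exact farField_F2_le' hr1.le hr2.le (hsmall s hs).1 (hsmall s hs).2)
    (fun s hs => by nlinarith [hbpos s hs.1, sq_nonneg (a s)])
    (by
      have h := (hsa.pow 2).add (hsb.pow 2)
      rw [zero_pow two_ne_zero, add_zero] at h
      exact h.congr fun s => by ring)
  have hs₀s₁ : ∀ s ∈ Ioc 0 s₀, s ∈ Ioc 0 s₁ := fun s hs => ⟨hs.1, hs.2.trans hs₀.2⟩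
  -- limits at `0⁺`
  have hda7 : ∀ s ∈ Ioo 0 s₀, |deriv a s| ≤ 7 * N := fun s hs => by
    have hs' : s ∈ Ioc 0 s₀ := ⟨hs.1, hs.2.le⟩
    rw [(hsolved s (hs₀s₁ s hs')).1]
    exact (farField_F1_le hr1.le hr2.le (hsmall s (hs₀s₁ s hs')).1 (hsmall s (hs₀s₁ s hs')).2).trans
      (by nlinarith [hbd s hs'])
  have hdb7 : ∀ s ∈ Ioo 0 s₀, |deriv b s| ≤ 7 * N := fun s hs => by
    have hs' : s ∈ Ioc 0 s₀ := ⟨hs.1, hs.2.le⟩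
    rw [(hsolved s (hs₀s₁ s hs')).2]
    exact (farField_F2_le' hr1.le hr2.le (hsmall s (hs₀s₁ s hs')).1 (hsmall s (hs₀s₁ s hs')).2).trans
      (by nlinarith [hbd s hs'])
  obtain ⟨a₀, ha₀⟩ := tendsto_nhdsGT_of_deriv_bounded hs₀.1 (fun s hs => hda s hs.1) hda7
  obtain ⟨b₀, hb₀⟩ := tendsto_nhdsGT_of_deriv_bounded hs₀.1 (fun s hs => hdb s hs.1) hdb7
  -- `b` stays away from `0`, so `b₀ > 0`
  obtain ⟨β, hβ, hβle⟩ : ∃ β : ℝ, 0 < β ∧ ∀ s ∈ Ioc 0 s₀, β ≤ b s := by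
    refine exists_pos_le_of_logDeriv_bounded (M := 9 / 2 * (Real.sqrt N + N)) hs₀.1
      (fun s hs => hdb s hs.1) (fun s hs => hbpos s hs.1) fun s hs => ?_
    have hs₁' := hs₀s₁ s hs
    rw [(hsolved s hs₁').2]
    refine (farField_F2_le hr1.le hr2.le (hsmall s hs₁').1 (hsmall s hs₁').2 hs.1.le
      (hs₁'.2.trans hs₁1)).trans ?_
    rw [abs_of_pos (hbpos s hs.1)]
    have h1 : |a s| ≤ Real.sqrt N := (Real.abs_le_sqrt (by nlinarith [sq_nonneg (b s)])).trans
      (Real.sqrt_le_sqrt (hbd s hs))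
    have h2 : |a s| + (a s ^ 2 + b s ^ 2) ≤ Real.sqrt N + N := add_le_add h1 (hbd s hs)
    have := mul_le_mul_of_nonneg_right h2 (hbpos s hs.1).le
    nlinarith
  have hb₀pos : 0 < b₀ :=
    lt_of_lt_of_le hβ (ge_of_tendsto hb₀ (by
      filter_upwards [Ioc_mem_nhdsGT hs₀.1] with s hs using hβle s hs))
  -- smooth extension across `s = 0`
  set Fv : ℝ × (ℝ × ℝ) → ℝ × ℝ := fun p =>
    ((((1 + p.1 * p.2.1) * ((1 - r) * (p.2.1 ^ 2 + p.2.2 ^ 2 / 3)) -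
          p.1 * p.2.2 / 3 * ((6 - 4 * r) / 3 * p.2.1 * p.2.2)) /
          (r * ((1 + p.1 * p.2.1) ^ 2 - (p.1 * p.2.2 / 3) ^ 2)),
        ((1 + p.1 * p.2.1) * ((6 - 4 * r) / 3 * p.2.1 * p.2.2) -
          p.1 * p.2.2 / 3 * ((1 - r) * (p.2.1 ^ 2 + p.2.2 ^ 2 / 3))) /
          (r * ((1 + p.1 * p.2.1) ^ 2 - (p.1 * p.2.2 / 3) ^ 2))) : ℝ × ℝ) with hFv
  set Ω : Set (ℝ × (ℝ × ℝ)) := {p | r * ((1 + p.1 * p.2.1) ^ 2 - (p.1 * p.2.2 / 3) ^ 2) ≠ 0} with hΩ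
  have hΩopen : IsOpen Ω := by
    have hcont : Continuous fun p : ℝ × (ℝ × ℝ) =>
        r * ((1 + p.1 * p.2.1) ^ 2 - (p.1 * p.2.2 / 3) ^ 2) := by fun_prop
    exact isOpen_compl_singleton.preimage hcont
  have hFvs : ContDiffOn ℝ ∞ Fv Ω := contDiffOn_farField_field r
  have h₀ : ((0 : ℝ), (a₀, b₀)) ∈ Ω := by simp [hΩ, hrne]
  have hy : ∀ s ∈ Ioo 0 s₀, HasDerivAt (fun s => (a s, b s)) (Fv (s, (a s, b s))) s := by
    intro s hs
    have hs' : s ∈ Ioc 0 s₁ := hs₀s₁ s ⟨hs.1, hs.2.le⟩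
    have h := (hda s hs.1).prodMk (hdb s hs.1)
    rw [(hsolved s hs').1, (hsolved s hs').2] at h
    exact h
  obtain ⟨ε, hε, Y, hYs, hY0, -, hYeq⟩ :=
    exists_smooth_extension_of_tendsto hΩopen hFvs h₀ hs₀.1 hy (ha₀.prodMk_nhds hb₀)
  -- the glued functions
  refine ⟨ε, hε, fun s => if 0 < s then a s else (Y s).1, fun s => if 0 < s then b s else (Y s).2,
    ?_, ?_, ?_, fun ζ hζ => ?_⟩
  · refine contDiffOn_of_locally_contDiffOn fun x hx => ?_
    by_cases hx0 : 0 < x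
    · refine ⟨Ioi 0, isOpen_Ioi, hx0, (has.mono inter_subset_right).congr fun s hs => ?_⟩
      exact if_pos hs.2
    · refine ⟨Ioo (-ε) ε, isOpen_Ioo, ⟨hx, lt_of_le_of_lt (not_lt.1 hx0) hε⟩,
        ((contDiff_fst.comp_contDiffOn hYs).mono inter_subset_right).congr fun s hs => ?_⟩
      by_cases hs0 : 0 < s
      · rw [if_pos hs0, Function.comp_apply, hYeq s ⟨hs0, hs.2.2⟩]
      · rw [if_neg hs0, Function.comp_apply]
  · refine contDiffOn_of_locally_contDiffOn fun x hx => ?_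
    by_cases hx0 : 0 < x
    · refine ⟨Ioi 0, isOpen_Ioi, hx0, (hbs.mono inter_subset_right).congr fun s hs => ?_⟩
      exact if_pos hs.2
    · refine ⟨Ioo (-ε) ε, isOpen_Ioo, ⟨hx, lt_of_le_of_lt (not_lt.1 hx0) hε⟩,
        ((contDiff_snd.comp_contDiffOn hYs).mono inter_subset_right).congr fun s hs => ?_⟩
      by_cases hs0 : 0 < s
      · rw [if_pos hs0, Function.comp_apply, hYeq s ⟨hs0, hs.2.2⟩]
      · rw [if_neg hs0, Function.comp_apply]
  · simp only [lt_self_iff_false, if_false, hY0]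
    exact hb₀pos
  · have hζr : 0 < ζ ^ (-r) := Real.rpow_pos_of_pos hζ _
    simp only [if_pos hζr]
    exact ⟨hUrep ζ hζ, hSrep ζ hζ⟩

/-- A function smooth on `(−ε, ∞)` agrees on `[−ε/2, ∞)` with a function smooth on `ℝ` (cut
off with Mathlib's `Real.smoothTransition`). [folklore] -/
theorem exists_contDiff_of_contDiffOn_Ioi {f : ℝ → ℝ} {ε : ℝ} (hε : 0 < ε)
    (hf : ContDiffOn ℝ ∞ f (Ioi (-ε))) :
    ∃ g : ℝ → ℝ, ContDiff ℝ ∞ g ∧ ∀ s, -ε / 2 ≤ s → g s = f s := by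
  set χ : ℝ → ℝ := fun s => Real.smoothTransition ((4 * s + 3 * ε) / ε) with hχ
  have hχs : ContDiff ℝ ∞ χ :=
    Real.smoothTransition.contDiff.comp (((contDiff_const.mul contDiff_id).add contDiff_const).div_const _)
  have hχ0 : ∀ s, s ≤ -(3 * ε / 4) → χ s = 0 := fun s hs =>
    Real.smoothTransition.zero_of_nonpos (div_nonpos_of_nonpos_of_nonneg (by linarith) hε.le)
  have hχ1 : ∀ s, -ε / 2 ≤ s → χ s = 1 := fun s hs =>
    Real.smoothTransition.one_of_one_le ((one_le_div hε).2 (by linarith))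
  refine ⟨fun s => χ s * f s, ?_, fun s hs => by simp only [hχ1 s hs, one_mul]⟩
  refine contDiff_iff_contDiffAt.2 fun x => ?_
  by_cases hx : -ε < x
  · exact ((hχs.contDiffOn.mul hf).contDiffAt (Ioi_mem_nhds hx) :)
  · have hev : (fun s => χ s * f s) =ᶠ[𝓝 x] fun _ => 0 := by
      filter_upwards [Iio_mem_nhds (show x < -(3 * ε / 4) by linarith)] with s hs
      rw [hχ0 s hs.le, zero_mul]
    exact (contDiffAt_const (c := (0 : ℝ))).congr_of_eventuallyEq hev

/-- **The far field of the self-similar profile**, global form of `farField_of_profile_Ioi`: the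
functions `A, B` may be taken smooth on all of `ℝ` (only their values on `[0, ∞)` are
determined by the profile). [cite: BuckmasterCaolaboraGomezserrano2025, Thm 1.1 and §2 (the point `P_∞`)]
[cite: CaolaboraEtAl2025, (1.6) p. 6] -/
theorem farField_of_profile {r : ℝ} {U S : ℝ → ℝ} (hr1 : 1 < r) (hr2 : r < 2)
    (hU : ContDiff ℝ ∞ fun y : V3 => (U ‖y‖ / ‖y‖) • y) (hS : ContDiff ℝ ∞ fun y : V3 => S ‖y‖)
    (hode : ∀ ζ : ℝ, 0 < ζ →
      (r - 1) * U ζ + (ζ + U ζ) * deriv U ζ + 1 / 3 * S ζ * deriv S ζ = 0 ∧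
      (r - 1) * S ζ + (ζ + U ζ) * deriv S ζ + 1 / 3 * S ζ * (deriv U ζ + 2 * U ζ / ζ) = 0)
    (hSpos : ∀ ζ : ℝ, 0 ≤ ζ → 0 < S ζ)
    (hlimU : Tendsto (fun ζ => U ζ / ζ) atTop (𝓝 0))
    (hlimS : Tendsto (fun ζ => S ζ / ζ) atTop (𝓝 0)) :
    ∃ A B : ℝ → ℝ, ContDiff ℝ ∞ A ∧ ContDiff ℝ ∞ B ∧ 0 < B 0 ∧ ∀ ζ : ℝ, 0 < ζ →
        U ζ = ζ ^ (1 - r) * A (ζ ^ (-r)) ∧ S ζ = ζ ^ (1 - r) * B (ζ ^ (-r)) := by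
  obtain ⟨ε, hε, A, B, hA, hB, hB0, hrep⟩ := farField_of_profile_Ioi hr1 hr2 hU hS hode hSpos hlimU hlimS
  obtain ⟨A', hA', hA'eq⟩ := exists_contDiff_of_contDiffOn_Ioi hε hA
  obtain ⟨B', hB', hB'eq⟩ := exists_contDiff_of_contDiffOn_Ioi hε hB
  refine ⟨A', B', hA', hB', by rw [hB'eq 0 (by linarith)]; exact hB0, fun ζ hζ => ?_⟩
  have hζr : 0 < ζ ^ (-r) := Real.rpow_pos_of_pos hζ _
  rw [hA'eq _ (by linarith), hB'eq _ (by linarith)]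
  exact hrep ζ hζ

end Assembly

end CaolaboraEtAl2025

end Literature.Analysis.FluidPDE
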